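import Summits.BirchSwinnertonDyer.BirchSwinnertonDyer.Theorems.AdditiveBranchIMCTwistRootNumberDyadic
import Literature.NumberTheory.EllipticCurves.QuadraticTwistNegOneLFunctionProofs
import HarnessLib

/-!
# The Atkin–Lehner sign at `2` of a POTENTIALLY MULTIPLICATIVE twist-type additive `2`: `λ₂(f_{E}) = χ_t(−1)` for `E = W₁^{(t)}`, `W₁`
# multiplicative at `2`, `t ∈ {−1, 2, −2}` (crux 19357 `GordTwoRankZeroOffCaseOne`, line `three_field_road`; groundwork for the bricks
# «`ℓ₀ = 2`» and «additive `2` on E3′ rows» of LeadReport26 §4; LEAD cruxlead-19357 g17, `--supports` 19357, helper only)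

Theorems only (no definition, no named fact, no `sorry`). The E3′ root-number engines exclude an additive `2` (`h2`) because the tree's
`localRootNumber` is the documented junk `0` there, so `λ₂` must be read on the modular side. For a twist-type additive `2` that is
POTENTIALLY MULTIPLICATIVE — `E = W₁ ⊗ χ_t` with `W₁` multiplicative at `2` (`2 ∥ N_{W₁}`) and `χ_t` the character of `ℚ(√t)`, `t ∈ {−1, 2, −2}`
(conductor `m = 4, 8, 8`) — the newform of `E` IS the twisted form `(f_{W₁})_{χ_t}` (`q`-expansions: `aₙ(E) = χ_t(n)aₙ(W₁)`, the tree's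
`LFunction_quadraticTwist_{neg_one,two,neg_two}_apply`), of level `M m²` with `N_{W₁} = 2M ∣ M m`, so the tree's «any modulus» law
`ModularForms.atkinLehnerEigenvalueAt_charTwist_primePow_of_eq` (Atkin–Lehner 1970 §6 / Atkin–Li 1978 §3; the pattern of
`TwistRootNumberDyadic.atkinLehnerEigenvalueAt_two_eq_one_of_cuspCoeff_eq_χ₈_mul_legendreSym_mul`, p-dyadic engine of the rank-one line) gives

  **`λ₂(f_E) = χ_t(−1)`** = `−1, +1, −1` for `t = −1, 2, −2` (Rohrlich: `w₂(St ⊗ χ) = χ₂(−1)`).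

* `atkinLehnerEigenvalueAt_two_eq_of_cuspCoeff_eq_primePowTwist_mul` — modular core for ONE quadratic primitive character mod `2^a`;
* `atkinLehnerEigenvalueAt_two_eq_neg_one_of_quadraticTwist_neg_one`, `…_eq_one_of_quadraticTwist_two`, `…_eq_neg_one_of_quadraticTwist_neg_two` —
  the three curve-side laws, with the level relation `N_{W₁} = 2M`, `N_E = M·m²` (`M` odd) taken as hypotheses (the engines discharge them
  from Ogg at `2`: `TwistRootNumberDyadic.conductorExponent_quadraticTwist_eq_six_of_hasMultiplicativeReductionAtPrime_two`,
  `QuadraticTwistTateFormTwoProofs.conductorExponent_eq_four_of_emod_four_eq_three`).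

References: [AtkinLehner1970] §6; [AtkinLi1978] §3; [Rohrlich1993Compositio] Prop. 2 (iii); [SilvermanAEC2009] X.5 Cor. 5.4, Ex. 10.16.
presearch: n/a (tree assembly). BSD is proved for no curve.
-/

set_option linter.dupNamespace false
set_option autoImplicit false

noncomputable section

open scoped MatrixGroups Classical

open CongruenceSubgroup Literature.NumberTheory.EllipticCurves Literature.NumberTheory.EllipticCurves.ModularForms
  IsDedekindDomain IsDedekindDomain.HeightOneSpectrum NumberField Rat.HeightOneSpectrum WeierstrassCurve
  Summit.BirchSwinnertonDyer.BirchSwinnertonDyer.Theorems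

namespace Summit.BirchSwinnertonDyer.BirchSwinnertonDyer.Theorems.TwistRootNumberTwisted

/-! ### §1 The modular core: one primitive quadratic character modulo `2^a` -/

section Modular

variable {N L M m : ℕ} [NeZero N] [NeZero L] [NeZero M] [NeZero m] {k : ℤ}

/-- **`λ₂(f') = χ(−1)` for a form `f' ∈ S_k(Γ₀(L))` with the `q`-expansion `aₙ(f') = χ(n)aₙ(f)` of the twist of `f ∈ S_k(Γ₀(N))` by a primitive
quadratic character `χ` modulo `m = 2^a`**, at the level `L = M·m²` with `M` odd and `N ∣ M·m` (so `v₂(N) ≤ a`: e.g. `2 ∥ N`): `f'` IS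
`charTwist_χ f` by the `q`-expansion principle, and `w_{m²}` acts on it by `χ(−1)` (`atkinLehnerEigenvalueAt_charTwist_primePow_of_eq`).
[cite: AtkinLi1978, §3] [cite: AtkinLehner1970, §6] -/
theorem atkinLehnerEigenvalueAt_two_eq_of_cuspCoeff_eq_primePowTwist_mul {a : ℕ} (ha : 0 < a) (hm : m = 2 ^ a) (h2M : ¬ 2 ∣ M)
    (hL : L = M * m ^ 2) (hNM : N ∣ M * m) {χ : DirichletCharacter ℂ m} (hχ : χ.IsQuadratic) (hprim : χ.IsPrimitive)
    {f : CuspForm (Gamma0 N) k} {f' : CuspForm (Gamma0 L) k} (hf'0 : f' ≠ 0)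
    (hcoeff : ∀ n : ℕ, cuspCoeff f' n = χ n * cuspCoeff f n) :
    atkinLehnerEigenvalueAt f' 2 = χ (-1) := by
  have hNL : N ∣ L := hNM.trans (by rw [hL, sq, ← mul_assoc]; exact dvd_mul_right _ _)
  have hmL : m ^ 2 ∣ L := by rw [hL]; exact dvd_mul_left _ _
  set g : CuspForm (Gamma0 L) k := charTwist L hNL hmL hχ f with hg
  have hfeq : f' = g := by
    refine eq_of_forall_cuspCoeff_eq_gamma0 fun n ↦ ?_
    rw [hg, cuspCoeff_charTwist L hNL hmL hχ hprim f n, hcoeff n]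
  rw [hfeq] at hf'0 ⊢
  rw [hg, atkinLehnerEigenvalueAt_charTwist_primePow_of_eq (p := 2) (a := a) (M := M) Nat.prime_two h2M hm ha hL hNM hNL hmL hχ
    (by rw [← hg]; exact hf'0)]

end Modular

/-! ### §2 The curve side: `E = W₁^{(t)}` with `W₁` multiplicative at `2` -/

variable (W : WeierstrassCurve ℚ) [W.IsElliptic]

/-- `f ≠ 0` for the newform of an elliptic curve. [folklore] -/
private theorem ne_zero_of_isNewformOf {N : ℕ} [NeZero N] {X : WeierstrassCurve ℚ} {f : CuspForm (Gamma0 N) 2}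
    (hf : IsNewformOf X f) : f ≠ 0 := fun h0 ↦ hf.1.coe_ne_zero (by rw [h0]; rfl)

/-- **`λ₂(f_E) = −1` for `E = W₁^{(−1)}` additive at `2`, `W₁` of level `2M` (`M` odd), `E` of level `16M`** (twist by `χ₋₄ = χ₄`, conductor `4`).
[cite: AtkinLi1978, §3] [cite: Rohrlich1993Compositio, Prop. 2 (iii)] [cite: SilvermanAEC2009, X.5 Cor. 5.4 and Ex. 10.16] -/
theorem atkinLehnerEigenvalueAt_two_eq_neg_one_of_quadraticTwist_neg_one {N N' M : ℕ} [NeZero N] [NeZero N'] [NeZero M]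
    (h2M : ¬ 2 ∣ M) (hN : N ∣ M * 4) (hN' : N' = M * 4 ^ 2)
    (hadd : ∀ v : HeightOneSpectrum (𝓞 ℚ), (primesEquiv v : ℕ) = 2 → (W.quadraticTwist (-1)).HasAdditiveReductionAt v)
    {f : CuspForm (Gamma0 N) 2} {f' : CuspForm (Gamma0 N') 2}
    (hf : IsNewformOf W f) (hf' : IsNewformOf (W.quadraticTwist (-1)) f') :
    atkinLehnerEigenvalueAt f' 2 = -1 := by
  haveI : NeZero (4 : ℕ) := ⟨by norm_num⟩
  have h := atkinLehnerEigenvalueAt_two_eq_of_cuspCoeff_eq_primePowTwist_mul (a := 2) (by norm_num) (by norm_num) h2M hN' hN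
    isQuadratic_χ₄_ringHomComp isPrimitive_χ₄_ringHomComp (ne_zero_of_isNewformOf hf') (f := f)
    (fun n ↦ by rw [hf'.2 n, hf.2 n]; exact W.LFunction_quadraticTwist_neg_one_apply_complex hadd n)
  rw [h, χ₄_ringHomComp_neg_one]

/-- **`λ₂(f_E) = +1` for `E = W₁^{(2)}` additive at `2`, `W₁` of level dividing `8M` (`M` odd), `E` of level `64M`** (twist by `χ₈`, conductor `8`).
[cite: AtkinLi1978, §3] [cite: Rohrlich1993Compositio, Prop. 2 (iii)] [cite: SilvermanAEC2009, X.5 Cor. 5.4 and Ex. 10.16] -/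
theorem atkinLehnerEigenvalueAt_two_eq_one_of_quadraticTwist_two {N N' M : ℕ} [NeZero N] [NeZero N'] [NeZero M]
    (h2M : ¬ 2 ∣ M) (hN : N ∣ M * 8) (hN' : N' = M * 8 ^ 2)
    (hadd : ∀ v : HeightOneSpectrum (𝓞 ℚ), (primesEquiv v : ℕ) = 2 → (W.quadraticTwist 2).HasAdditiveReductionAt v)
    {f : CuspForm (Gamma0 N) 2} {f' : CuspForm (Gamma0 N') 2}
    (hf : IsNewformOf W f) (hf' : IsNewformOf (W.quadraticTwist 2) f') :
    atkinLehnerEigenvalueAt f' 2 = 1 := by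
  haveI : NeZero (8 : ℕ) := ⟨by norm_num⟩
  have h := atkinLehnerEigenvalueAt_two_eq_of_cuspCoeff_eq_primePowTwist_mul (a := 3) (by norm_num) (by norm_num) h2M hN' hN
    isQuadratic_χ₈_ringHomComp isPrimitive_χ₈_ringHomComp (ne_zero_of_isNewformOf hf') (f := f)
    (fun n ↦ by rw [hf'.2 n, hf.2 n]; exact W.LFunction_quadraticTwist_two_apply_complex hadd n)
  rw [h, χ₈_ringHomComp_neg_one]

/-- **`λ₂(f_E) = −1` for `E = W₁^{(−2)}` additive at `2`, `W₁` of level dividing `8M` (`M` odd), `E` of level `64M`** (twist by `χ₋₈ = χ₈'`, conductor `8`).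
[cite: AtkinLi1978, §3] [cite: Rohrlich1993Compositio, Prop. 2 (iii)] [cite: SilvermanAEC2009, X.5 Cor. 5.4 and Ex. 10.16] -/
theorem atkinLehnerEigenvalueAt_two_eq_neg_one_of_quadraticTwist_neg_two {N N' M : ℕ} [NeZero N] [NeZero N'] [NeZero M]
    (h2M : ¬ 2 ∣ M) (hN : N ∣ M * 8) (hN' : N' = M * 8 ^ 2)
    (hadd : ∀ v : HeightOneSpectrum (𝓞 ℚ), (primesEquiv v : ℕ) = 2 → (W.quadraticTwist (-2)).HasAdditiveReductionAt v)
    {f : CuspForm (Gamma0 N) 2} {f' : CuspForm (Gamma0 N') 2}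
    (hf : IsNewformOf W f) (hf' : IsNewformOf (W.quadraticTwist (-2)) f') :
    atkinLehnerEigenvalueAt f' 2 = -1 := by
  haveI : NeZero (8 : ℕ) := ⟨by norm_num⟩
  have h := atkinLehnerEigenvalueAt_two_eq_of_cuspCoeff_eq_primePowTwist_mul (a := 3) (by norm_num) (by norm_num) h2M hN' hN
    isQuadratic_χ₈'_ringHomComp isPrimitive_χ₈'_ringHomComp (ne_zero_of_isNewformOf hf') (f := f)
    (fun n ↦ by rw [hf'.2 n, hf.2 n]; exact W.LFunction_quadraticTwist_neg_two_apply_complex hadd n)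
  rw [h, χ₈'_ringHomComp_neg_one]

end Summit.BirchSwinnertonDyer.BirchSwinnertonDyer.Theorems.TwistRootNumberTwisted

end
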